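import Summits.CriticalPhenomena.PercolationContinuityZ3.Theorems.Transplant.SkelNeg1ParamsP
import Summits.CriticalPhenomena.PercolationContinuityZ3.Theorems.Transplant.SkelNegParamsLattice
import Summits.CriticalPhenomena.PercolationContinuityZ3.Theorems.Transplant.SkelPhiStepINegDefs
import HarnessLib

/-!
# N1 params, part 3a (O-level values, skeleton-level): THE SHORT SCALE, THE KIT, THE COUNTS AND THE LONG BOX of the {±1} node's choice function as
# functions of the Step-I″ record `D : Skelφ.StepI.DataN V` (p272964) — `PlanarSkeletonNeg.Neg.Mu/ρz/nS/hS/ℓS/vS/As/Mk/T₀/Kd/cU/Rseed/rs/sB/B/kP/NP/Lcnt/Rlev/R'/ML/n₁L`,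
# i.e. NEG-PARAMS (n3)–(n5)/(n7) up to and including `M_L` (the long WIDTH `n_L` waits for the (R) column's clearance numbers `d₀, q` — (n5)(v))

builds on p205010 (kernel theorem, internal audit signed; external expert review pending) — nothing in this file uses p205010; NOTHING is claimed about
the node `SamePDropOfSkeletonNeg₁` (OPEN).
Status sentence (coordinator 2026-08-20T04:30Z): "θ(p_c) = 0 on ℤ^d, all d ≥ 2 — kernel-verified (Lean 4/Mathlib, standard axioms); internal adversarial
audit SIGNED 2026-08-20 04:29Z; external expert review pending."
Lane `prim-bschramm-*`, seat `prim-bschramm-stmt` (gen 12); helper file (`--supports stmt-CriticalPhenomena-4575 --as helper`); ledger HOME/prim-bschramm-stmt/NEG-PARAMS.md v0.6.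
ORDER (N.3 for N1, O-level part, every value a SEPARATE small definition so the unpacking files state facts by name): Step I″ hands `D` (`Λ, k, R, M₀, n₁ : ℕ → ℕ`,
`hgt/len/spl : V → ℕ → ℕ → _`; `StepI.exists_stepI_neg`, p3) → zone scale **`Mu := D.M₀`** (`Sz = {Mu}`), zone radius **`ρz := D.R Mu`** (no offset in N1) → short width
**`nS := NegPrm.nS (D.n₁ Mu) Mu 0 ρz = max (n₁ Mu) (Mu + 2 + ρz)`** (`R′`-free, v0.5 (n4)′) → short data **`(hS, ℓS, vS) := (D.hgt, D.len, D.spl) t Mu nS`** at the TYPE `t` → kit square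
**`As := NegPrm.As nS hS ℓS = D.scale t Mu nS`** (`As_eq_scale`, rfl), clamp `Mk`, `T₀ := tanOff Mk Mk`, depth `Kd`, `cU`, `Rseed`, `rs` (SkelNeg1ParamsKit at `R := D.R`) → Step-III sizes `sB, B` →
counts at `p`: `kP, NP, Lcnt` (`kitK/kitN/kitL` at `Neg.δkit`, verbatim D″) → levels `Rlev := T₀ + Lcnt`, **`R′ := Rlev + 1`** → long box
**`ML := NegPrm.ML Mu C′ c_max (4·K) R′ |hS| ℓS nS`** (floors `2C′(|h_s|+ℓ_s+n_s)`, `960 − 1`, `4K(R′+2)`, `Mu`) → long threshold `n₁L := D.n₁ ML`.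
* §1 the values; §2 the facts by name: `M₀_le_Mu`, `n₁_le_nS`, `Mu_lt_nS`, `ρz_le_nS`, `As_eq_scale`, `Mu_succ_le_As`, `one_le_R'`, `T₀_eq`, the `M_L` floors
  (`Mu_le_ML`, `hop_floor_le_ML`, `slack_floor_le_ML : 960 ≤ ML + 1`, `coarse_floor_le_ML : 4K(R′+2) ≤ ML`, `kit_floors_ML : 4K·R′+2 ≤ ML ∧ 4K+2 ≤ ML ∧ 8K+2 ≤ ML`), and the SHORT-pair
  unpacking of `D.EqGeom` (`eqGeomS_facts : Mu < nS ∧ Mu < ℓS ∧ |vS| ≤ nS ∧ (Mu+1)(nS+|hS|) ≤ nS(ℓS+1)`).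
[cite: KozmaNitzan2024, §4 Theorem 6 (pp. 25–31): the order of constants; Lemma 10 Steps II–III (pp. 18–19)] [cite: MartineauTassion2017, §3.2 Lemma 3.5, §3.3 Lemma 3.7]
-/

noncomputable section

open scoped Classical

namespace Summit.CriticalPhenomena.PercolationContinuityZ3.Theorems.Transplant

namespace PlanarSkeletonNeg

namespace Neg

open Literature.Probability.Percolation Literature.Probability.LatticeModels SimpleGraph
open SkelConc (Consts)
open BoxProdZ2 (kitK kitN kitL)
open SkelI (tanOff)

section Data

variable {V : Type} (t : V) (D : Skelφ.StepI.DataN V)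

/-! ## §1 The values read off `D` alone -/

/-- **The zone scale** `M_u := D.M₀` (the list of zone sizes is `{M_u}`; `D.k ≤ M₀` is a Step-I″ fact). [this work] -/
def Mu : ℕ := D.M₀

/-- **The zone graph-radius** `ρz := D.R M_u` (the uniqueness zone at scale `M_u` lies in `graphBall c (R M_u)`; N1 has no seed offset). [this work] -/
def ρz : ℕ := D.R (Mu D)

/-- **The short (kit-route) width** `n_s := max (n₁ M_u) (M_u + 2 + ρz)` (`NegPrm.nS` with the `R′` slot at `0`, NEG-PARAMS v0.5 (n4)′). [this work] -/
def nS : ℕ := Skelφ.NegPrm.nS (D.n₁ (Mu D)) (Mu D) 0 (ρz D)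

/-- The short shear `h_s := D.hgt t M_u n_s` (at the TYPE `t`). [this work] -/
def hS : ℤ := D.hgt t (Mu D) (nS D)

/-- The short half-length `ℓ_s := D.len t M_u n_s`. [this work] -/
def ℓS : ℕ := D.len t (Mu D) (nS D)

/-- The short split point `v_s := D.spl t M_u n_s`. [this work] -/
def vS : ℤ := D.spl t (Mu D) (nS D)

/-- **The kit square half-width** `As := pgScale n_s h_s (3ℓ_s)` (= `D.scale t M_u n_s`). [this work] -/
def As : ℕ := Skelφ.NegPrm.As (nS D) (hS t D) (ℓS t D)

/-- **The clamp = seed-slab scale** `Mk := max (M_u + 1) As`. [this work] -/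
def Mk : ℕ := Skelφ.NegPrm.Mk (Mu D) (nS D) (hS t D) (ℓS t D)

/-- The clamp offset `T₀ := tanOff Mk Mk = 3·Mk + 2`. [this work] -/
def T₀ : ℕ := tanOff (Mk t D) (Mk t D)

/-- The kit depth `Kd := Mk + 1 + Mk + max (R As) ρz`. [this work] -/
def Kd : ℕ := Skelφ.NegPrm.Kd D.R (Mu D) (nS D) (hS t D) (ℓS t D) (ρz D)

/-! ## §2a The facts read off `D` alone -/

/-- `D.M₀ ≤ M_u` (zone admissibility: `Prm.SzOf_adm`). [folklore] -/
theorem M₀_le_Mu : D.M₀ ≤ Mu D := le_rfl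

/-- `D.k ≤ M_u` from the Step-I″ fact `D.k ≤ D.M₀`. [folklore] -/
theorem k_le_Mu (hk : D.k ≤ D.M₀) : D.k ≤ Mu D := hk

/-- `n₁ M_u ≤ n_s` (the short pair is admissible). [folklore] -/
theorem n₁_le_nS : D.n₁ (Mu D) ≤ nS D := Skelφ.NegPrm.n₁_le_nS _ _ _ _

/-- `M_u < n_s` and `M_u + 2 + ρz ≤ n_s`. [folklore] -/
theorem Mu_lt_nS : Mu D < nS D ∧ Mu D + 2 + ρz D ≤ nS D :=
  ⟨Skelφ.NegPrm.Mu_lt_nS _ _ _ _, by have := Skelφ.NegPrm.floor_le_nS (D.n₁ (Mu D)) (Mu D) 0 (ρz D); unfold nS; omega⟩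

/-- `ρz ≤ n_s`. [folklore] -/
theorem ρz_le_nS : ρz D ≤ nS D := (Skelφ.NegPrm.R'_le_nS _ _ _ _).2

/-- **The kit square is Step I″'s link-region scale at the short pair**: `As = D.scale t M_u n_s`. [folklore] -/
theorem As_eq_scale : As t D = D.scale t (Mu D) (nS D) := rfl

/-- `As = pgScale n_s h_s (3ℓ_s)`. [folklore] -/
theorem As_eq : As t D = Skelφ.pgScale (nS D) (hS t D) (3 * ℓS t D) := rfl

/-- `M_u + 1 ≤ As` and `n_s ≤ As`. [folklore] -/
theorem Mu_succ_le_As : Mu D + 1 ≤ As t D ∧ nS D ≤ As t D :=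
  ⟨(Mu_lt_nS D).1 |> fun h => le_trans h (Skelφ.NegPrm.ns_le_As _ _ _), Skelφ.NegPrm.ns_le_As _ _ _⟩

/-- `Mk = As` (the clamp scale is the kit square). [folklore] -/
theorem Mk_eq_As : Mk t D = As t D := Skelφ.NegPrm.Mk_eq_As (Mu D) (nS D) (hS t D) (ℓS t D) (Mu_lt_nS D).1

/-- `T₀ = 3·Mk + 2`. [folklore] -/
theorem T₀_eq : T₀ t D = 3 * Mk t D + 2 := Skelφ.NegPrm.tanOff_Mk _ _ _ _

end Data

section OLevel

variable (κ : Consts) {V : Type} [DecidableEq V] [Countable V] {G : SimpleGraph V} [G.LocallyFinite] (Φ : PlanarSkeletonNeg G) (t : V)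
  (p : unitInterval) (D : Skelφ.StepI.DataN V)

/-! ## §1b The values that read the skeleton (degree bound, frames) and the density -/

/-- The face-count bound `cU := (Δ+1)^{R As}`. [this work] -/
def cU : ℕ := Skelφ.NegPrm.cU D.R (nS D) (hS t D) (ℓS t D) Φ.Δ

/-- The seed-slab radius `Rseed` (frame-uniform comparison radii). [this work] -/
def Rseed : ℕ := Skelφ.NegPrm.Rseed D.R (Mu D) (nS D) (hS t D) (ℓS t D) G Φ.φ Φ.types

/-- The shell radius `rs` (also the near/far threshold of the kit). [this work] -/
def rs : ℕ := Skelφ.NegPrm.rs D.R (Mu D) (nS D) (hS t D) (ℓS t D) (ρz D) G Φ.φ Φ.types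

/-- The Step-III seed-size bound `sB := 1 + Δ((Δ+1)^{Rseed} + T₀ + 2) + ((Δ+1)^{Rseed} + T₀ + 2)·cU`. [this work] -/
def sB : ℕ := 1 + Φ.Δ * ((Φ.Δ + 1) ^ Rseed Φ t D + (T₀ t D + 2)) + ((Φ.Δ + 1) ^ Rseed Φ t D + (T₀ t D + 2)) * cU Φ t D

/-- The contact multiplier `B := (Δ+1)^{2 rs}`. [this work] -/
def B : ℕ := (Φ.Δ + 1) ^ (2 * rs Φ t D)

/-- The number of seeds `k` at `(Δ, sB, B, δkit, p)`. [this work] -/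
def kP : ℕ := kitK Φ.Δ (sB Φ t D) (B Φ t D) (Neg.δkit κ Φ) p

/-- The number of contacts `N`. [this work] -/
def NP : ℕ := kitN Φ.Δ (sB Φ t D) (B Φ t D) (Neg.δkit κ Φ) p

/-- The number of levels `Lcnt`. [this work] -/
def Lcnt : ℕ := kitL Φ.Δ (sB Φ t D) (B Φ t D) (Neg.δkit κ Φ) p

/-- The window depth in levels `Rlev := T₀ + Lcnt`. [this work] -/
def Rlev : ℕ := T₀ t D + Lcnt κ Φ t p D

/-- **The band growth / kit-level displacement** `R′ := Rlev + 1` (φ-rows; in run units `R′ + 1`, p1's `SkelPhiParaRunDisp`). [this work] -/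
def R' : ℕ := Rlev κ Φ t p D + 1

/-- **The long BOX** `M_L := ML M_u C′ c_max (4K) R′ |h_s| ℓ_s n_s` (chosen AFTER the short data and the kit levels; every floor lives here). [this work] -/
def ML : ℕ := Skelφ.NegPrm.ML (Mu D) Neg.C' Neg.cmax (4 * Neg.K κ) (R' κ Φ t p D) (hS t D).natAbs (ℓS t D) (nS D)

/-- The long width threshold `n₁ M_L` (the long width `n_L ≥ max (n₁ M_L) (M_L + 1) …` is fixed in part 3b with the (R) clearance slot). [this work] -/
def n₁L : ℕ := D.n₁ (ML κ Φ t p D)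

/-! ## §2b The facts that read the counts -/

/-- `n_s < T₀ < R′`: the kit levels sit above the short scale (v0.5 (n11)). [folklore] -/
theorem nS_lt_R' : nS D < T₀ t D ∧ T₀ t D < R' κ Φ t p D := by
  refine ⟨Skelφ.NegPrm.ns_lt_tanOff _ _ _ _, ?_⟩
  unfold R' Rlev; omega

/-- `1 ≤ R′` and `T₀ + 1 ≤ R′`. [folklore] -/
theorem one_le_R' : 1 ≤ R' κ Φ t p D ∧ T₀ t D + 1 ≤ R' κ Φ t p D := by unfold R' Rlev; omega

/-- `M_u ≤ M_L`. [folklore] -/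
theorem Mu_le_ML : Mu D ≤ ML κ Φ t p D := Skelφ.NegPrm.Mu_le_ML _ _ _ _ _ _ _ _

/-- D4's floor `2C′(|h_s| + ℓ_s + n_s) ≤ M_L` with `C′ = 8`. [folklore] -/
theorem hop_floor_le_ML : 2 * Neg.C' * ((hS t D).natAbs + ℓS t D + nS D) ≤ ML κ Φ t p D := Skelφ.NegPrm.hop_floor_le_ML _ _ _ _ _ _ _ _

/-- The y′-layer slack floor `960 ≤ M_L + 1` (`320·c_max`, `c_max = 3`). [folklore] -/
theorem slack_floor_le_ML : 960 ≤ ML κ Φ t p D + 1 := by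
  have h := Skelφ.NegPrm.slack_floor_le_ML (Mu D) Neg.C' Neg.cmax (4 * Neg.K κ) (R' κ Φ t p D) (hS t D).natAbs (ℓS t D) (nS D)
  rw [Neg.cmax_eq.2] at h
  exact h

/-- The coarse floor `4K(R′+2) ≤ M_L` (and `4K ≤ M_L`). [folklore] -/
theorem coarse_floor_le_ML : 4 * Neg.K κ * (R' κ Φ t p D + 2) ≤ ML κ Φ t p D ∧ 4 * Neg.K κ ≤ ML κ Φ t p D :=
  Skelφ.NegPrm.coarse_floor_le_ML _ _ _ _ _ _ _ _

/-- **The kit-drift / ρ-Lipschitz / representative floors**: `4K·R′ + 2 ≤ M_L`, `4K + 2 ≤ M_L`, `8K + 2 ≤ M_L` (the hypotheses of `coarse_drift_le_one`, `lip_coarse`,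
`exists_coarse_eq` at `M := M_L`). [folklore] -/
theorem kit_floors_ML : 4 * Neg.K κ * R' κ Φ t p D + 2 ≤ ML κ Φ t p D ∧ 4 * Neg.K κ + 2 ≤ ML κ Φ t p D ∧ 8 * Neg.K κ + 2 ≤ ML κ Φ t p D := by
  obtain ⟨h1, h2, -, -⟩ := Skelφ.NegPrm.kit_floor_of_ML (Neg.forty_le_K κ).2.2 (Mu D) Neg.C' Neg.cmax (R' κ Φ t p D) (hS t D).natAbs (ℓS t D) (nS D)
  have h3 := (coarse_floor_le_ML κ Φ t p D).1
  have hR := (one_le_R' κ Φ t p D).1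
  have hK := (Neg.forty_le_K κ).2.2
  refine ⟨h1, h2, ?_⟩
  have e : 4 * Neg.K κ * (R' κ Φ t p D + 2) = 4 * Neg.K κ * R' κ Φ t p D + 8 * Neg.K κ := by ring
  rw [e] at h3
  nlinarith

/-- `n_s < M_L + 1` hence the long scale will dominate the short one (`2C′ n_s ≤ M_L`, `C′ = 8`). [folklore] -/
theorem nS_le_ML : nS D ≤ ML κ Φ t p D := by
  have h := hop_floor_le_ML κ Φ t p D
  rw [Neg.C'_eq.1] at h
  omega

omit [DecidableEq V] [Countable V] in
/-- **The short pair's geometric clause unpacked** (from `D.EqGeom G Φ.φ t M_u n_s`, a Step-I″ output at every admissible pair): `M_u < n_s`, `M_u < ℓ_s`, `|v_s| ≤ n_s`,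
`(M_u+1)(n_s+|h_s|) ≤ n_s(ℓ_s+1)` — in the `ℤ` shapes `SkelNegParamsCoarse/Lattice` consume. [folklore] -/
theorem eqGeomS_facts (hE : D.EqGeom G Φ.φ t (Mu D) (nS D)) :
    Mu D < nS D ∧ Mu D < ℓS t D ∧ |vS t D| ≤ (nS D : ℤ) ∧ ((Mu D : ℤ) + 1) * ((nS D : ℤ) + |hS t D|) ≤ (nS D : ℤ) * ((ℓS t D : ℤ) + 1) := by
  obtain ⟨h1, h2, h3, h4, -⟩ := hE
  refine ⟨h1, h2, h3, ?_⟩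
  have e1 : (((nS D) + (D.hgt t (Mu D) (nS D)).natAbs : ℕ) : ℤ) = (nS D : ℤ) + |hS t D| := by push_cast; rfl
  have e2 : (((D.len t (Mu D) (nS D)) + 1 : ℕ) : ℤ) = (ℓS t D : ℤ) + 1 := by push_cast; rfl
  rw [e1, e2] at h4
  exact h4

end OLevel

end Neg

end PlanarSkeletonNeg

end Summit.CriticalPhenomena.PercolationContinuityZ3.Theorems.Transplant

end
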